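import Summits.Langlands.Langlands.Theorems.IrreducibilityBySelfDualityRegularTwistFromHalfIntegral
import Literature.NumberTheory.Automorphic.StrongMultiplicityOneRepDataAE
import HarnessLib

/-!
# `RegularTwistFromHalfIntegral` (route `IrreducibilityBySelfDuality`, item stmt-Langlands-14726):
# the glue `HalfIntegralTwistCM → RegularTwistCM` modulo THREE named facts (the Borel–Jacquet
# dictionary `hasSatakeParamAt_iff_L2` removed)

`IrreducibilityBySelfDualityRegularTwistFromHalfIntegral.lean` proves the route decl
`RegularTwistFromHalfIntegral` (`HalfIntegralTwistCM → RegularTwistCM`) from FOUR named facts of the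
tree: Gelbart–Jacquet 1978 Thm. (9.3) with its archimedean clause
(`GelbartJacquet_adjoint_lift_archimedean`), the Borel–Jacquet dictionary `hasSatakeParamAt_iff_L2`
(rank `3`, every automorphic measure), Jacquet–Shalika's strong multiplicity one
`strong_multiplicity_one_gl_sphericalLevel 3 K`, and Clozel's existence of an infinity type for
cuspidal `GL₂` data (`exists_hasInfinityType`). The second fact entered only through the archimedean
form of strong multiplicity one (`CuspidalAutomorphicRepData.hasArchParameter_eq_of_isNearlyEquivalent`),
which the tree now proves from `strong_multiplicity_one_gl_sphericalLevel` ALONE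
(`hasArchParameter_eq_of_isNearlyEquivalent_of_smo`, `StrongMultiplicityOneRepDataAE`: the
dictionary is only needed at almost every place, where it is the theorem
`hasSatakeParamAt_iff_L2_eventually`). This file records the sharper conditional result:

* `RegularTwistFromHalfIntegral.adjointArchShadowNonDihedral_of_GJ_smo` — the adjoint archimedean
  shadow (the r3 skeleton's stub 1a, verbatim signature) from `GelbartJacquet_adjoint_lift_archimedean`
  and `strong_multiplicity_one_gl_sphericalLevel 3` only;
* `RegularTwistFromHalfIntegral_of_GJ_smo_infinityType` — the route decl from the THREE named facts
  `GelbartJacquet_adjoint_lift_archimedean`, `strong_multiplicity_one_gl_sphericalLevel 3 K` (all `K`)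
  and `exists_hasInfinityType` (cuspidal rank-`2` data). CONDITIONAL result: the item closes the day
  these three are discharged. Of the third, the EXISTENCE half (an archimedean parameter) is the
  theorem `AutomorphicRepData.exists_hasArchParameter_gl`; what is consumed beyond it is the integral
  pairing `s₁ ι - s₁ ῑ ∈ ℤ` of the exponents of `σ₀` at a complex place (hypothesis (ii) of
  `HalfIntegralTwistCM`), i.e. archimedean representation theory of `GL₂(ℂ)` (Clozel 1990, §3.3).
-/

set_option linter.dupNamespace false

noncomputable section

open scoped ComplexConjugate Classical
open NumberField Filter
open Literature.NumberTheory.Automorphic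

namespace Summit.Langlands.Langlands.Theorems

namespace RegularTwistFromHalfIntegral

/-- **The adjoint archimedean shadow for non-dihedral `σ₀`, modulo Gelbart–Jacquet at infinity and
`strong_multiplicity_one_gl_sphericalLevel 3` only** (the skeleton's stub 1a, verbatim): for cuspidal
`π` (`GL₃`), non-dihedral `σ₀` (`GL₂`) and `ν` (`GL₁`) with `t_π = d · Ad(t_{σ₀})` a.e., at an embedding
where `σ₀` has parameter `{x, y}` and `ν` has `{q}`, `π` has `{x - y + q, q, y - x + q}`. Proof: as
`adjointArchShadowNonDihedral_of_GJ` — the Gelbart–Jacquet lift `P` of `σ₀` (named fact, with its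
archimedean clause), its twist `P' = P ⊗ ν` (`stub_twistRealisation`, proved), `π` and `P'` nearly
equivalent (Satake uniqueness for `ν`, Flath), hence with the same archimedean parameter — now by
`hasArchParameter_eq_of_isNearlyEquivalent_of_smo`, which needs no Borel–Jacquet dictionary.
[cite: GelbartJacquet1978, Thm. (9.3), Prop. (3.2)] [cite: JacquetShalikaAJM1981II, Thm. 4.4] -/
theorem adjointArchShadowNonDihedral_of_GJ_smo
    (hGJ : GelbartJacquet_adjoint_lift_archimedean)
    (hsmo : ∀ (K : Type) [Field K] [NumberField K], strong_multiplicity_one_gl_sphericalLevel 3 K) :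
    ∀ (K : Type) [Field K] [NumberField K]
      (h1 : isCompact_glFiniteIntegralLevel 1 K) (hcpt₂ : isCompact_glFiniteIntegralLevel 2 K)
      (hcpt : isCompact_glFiniteIntegralLevel 3 K)
      (π : CuspidalAutomorphicRepData 3 K hcpt) (σ₀ : CuspidalAutomorphicRepData 2 K hcpt₂)
      (ν : CuspidalAutomorphicRepData 1 K h1),
      (∀ (L : Type) [Field L] [NumberField L] [Algebra K L], Module.finrank K L = 2 →
        ¬ IsQuadraticSelfTwistAE L σ₀.1) →
      (∀ᶠ v in cofinite, ∀ α β : Multiset ℂ, π.1.HasSatakeParamAt v α →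
        σ₀.1.HasSatakeParamAt v β → ∃ d : ℂ, ν.1.HasSatakeParamAt v {d} ∧
          α = (((β ×ˢ β).map (fun r : ℂ × ℂ => r.1 * r.2⁻¹)).erase 1).map (fun e => d * e)) →
      ∀ (χπ χσ χν : (K →+* ℂ) → Multiset ℂ),
        π.1.HasArchParameter χπ → σ₀.1.HasArchParameter χσ → ν.1.HasArchParameter χν →
        ∀ (ι : K →+* ℂ) (x y q : ℂ), χσ ι = {x, y} → χν ι = {q} →
          χπ ι = {x - y + q, q, y - x + q} := by
  intro K _ _ h1 hcpt₂ hcpt π σ₀ ν hnd hAd χπ χσ χν hπ hσ hν ι x y q hxy hq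
  classical
  haveI : NeZero (3 : ℕ) := ⟨by norm_num⟩
  -- the parameter of `ν` is a family of singletons `{p σ}`
  have h1c : ∀ σ : K →+* ℂ, ∃ a : ℂ, χν σ = {a} := fun σ =>
    Multiset.card_eq_one.mp (AutomorphicRepData.card_eq_of_hasArchParameter hν σ)
  choose p hp using h1c
  have hνp : ν.1.HasArchParameter (fun σ => {p σ}) := by
    have e : χν = fun σ => {p σ} := funext hp
    rw [← e]
    exact hν
  -- the Gelbart–Jacquet lift `P` of `σ₀` with its archimedean clause (named fact)
  obtain ⟨P, hPsat, hParch⟩ := hGJ K hcpt₂ hcpt σ₀ hnd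
  have hPχ : P.1.HasArchParameter (fun σ => (((χσ σ) ×ˢ (χσ σ)).map fun r => r.1 - r.2).erase 0) :=
    hParch χσ hσ
  -- the twist `P' = P ⊗ ν` (proved stub 5)
  obtain ⟨P', hP'arch, hP'sat⟩ :=
    RegularTwistCM.stub_twistRealisation 3 K h1 hcpt P ν _ p hPχ hνp
  -- `π` and `P'` are nearly equivalent
  have hne : π.1.IsNearlyEquivalent P'.1 := by
    have hcπ : ∀ᶠ v in cofinite, π.1.IsUnramifiedAt v :=
      AutomorphicRepData.hasSatakeParamAt_cofinite_holds π.1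
    have hcσ : ∀ᶠ v in cofinite, σ₀.1.IsUnramifiedAt v :=
      AutomorphicRepData.hasSatakeParamAt_cofinite_holds σ₀.1
    filter_upwards [hAd, hPsat, hP'sat, hcπ, hcσ] with v hv hPv hP'v hπv hσv
    obtain ⟨α, hα⟩ := hπv
    obtain ⟨β, hβ⟩ := hσv
    obtain ⟨d, hd, hαeq⟩ := hv α β hα hβ
    obtain ⟨c, hc, hP'c⟩ := hP'v (adParams β) (hPv β hβ)
    have hcd : c = d :=
      Multiset.singleton_inj.mp (AutomorphicRepData.hasSatakeParamAt_unique_holds ν.1 hc hd)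
    have had : adParams β = ((β ×ˢ β).map (fun r : ℂ × ℂ => r.1 * r.2⁻¹)).erase 1 := rfl
    refine ⟨α, hα, ?_⟩
    rw [hαeq, ← had, ← hcd]
    exact hP'c
  -- strong multiplicity one with the archimedean components (tree, modulo `hsmo` alone)
  obtain ⟨μm, hμm⟩ := AdelicGroupData.exists_isAutomorphicMeasure_gl_holds 3 K
  haveI := hμm
  have heq := CuspidalAutomorphicRepData.hasArchParameter_eq_of_isNearlyEquivalent_of_smo
    (μm := μm) (hsmo K) π P' hne hπ hP'arch
  -- read off at `ι`
  have hpq : p ι = q := by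
    have h := hp ι
    rw [hq] at h
    exact (Multiset.singleton_inj.mp h).symm
  have hι : χπ ι = ((((χσ ι) ×ˢ (χσ ι)).map fun r => r.1 - r.2).erase 0).map (· + p ι) :=
    congr_fun heq ι
  rw [hι, hxy, hpq]
  exact (RegularTwistCM.Negative.adjointShape_eq x y q).symm

end RegularTwistFromHalfIntegral

open RegularTwistFromHalfIntegral

/-- **`RegularTwistFromHalfIntegral` modulo three archimedean named facts** (CONDITIONAL result,
sharpening `RegularTwistFromHalfIntegral_of`): the route decl `HalfIntegralTwistCM → RegularTwistCM`
follows from Gelbart–Jacquet 1978 Thm (9.3) with its archimedean clause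
(`GelbartJacquet_adjoint_lift_archimedean`), Jacquet–Shalika's strong multiplicity one
`strong_multiplicity_one_gl_sphericalLevel 3 K` and Clozel's existence of an infinity type for
cuspidal `GL₂` data (`exists_hasInfinityType`; the integral pairing). The Borel–Jacquet dictionary
`hasSatakeParamAt_iff_L2` of `RegularTwistFromHalfIntegral_of` is no longer a hypothesis.
[cite: GelbartJacquet1978, Thm. (9.3)] [cite: JacquetShalikaAJM1981II, Thm. 4.4]
[cite: Clozel1990, §3.3 and Lemme 4.9] -/
theorem RegularTwistFromHalfIntegral_of_GJ_smo_infinityType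
    (hGJ : GelbartJacquet_adjoint_lift_archimedean)
    (hsmo : ∀ (K : Type) [Field K] [NumberField K], strong_multiplicity_one_gl_sphericalLevel 3 K)
    (hIT : ∀ (K : Type) [Field K] [NumberField K] (hcpt₂ : isCompact_glFiniteIntegralLevel 2 K)
      (σ₀ : CuspidalAutomorphicRepData 2 K hcpt₂), σ₀.1.exists_hasInfinityType) :
    Summit.Langlands.Langlands.Theses.IrreducibilityBySelfDuality.RegularTwistFromHalfIntegral :=
  RegularTwistFromHalfIntegral_of_inputs (adjointArchShadowNonDihedral_of_GJ_smo hGJ hsmo) hIT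

end Summit.Langlands.Langlands.Theorems

end
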